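import Summits.QuantumFields.BalabanUV.T4Continuum.Support.NE7StraightDefectAssemblyV2
import Summits.QuantumFields.BalabanUV.T4Continuum.Support.NE7SmoothProductCutoff
import Summits.QuantumFields.BalabanUV.T4Continuum.Support.NE7TorusRoadGeometry
import Summits.QuantumFields.BalabanUV.T4Continuum.Support.NE7CoarseSplitAssembly
import Summits.QuantumFields.BalabanUV.T4Continuum.Support.NE7CoarseCurvatureLetterLocal
import Summits.QuantumFields.BalabanUV.T4Continuum.Support.NE7TanCriticalGauge
import HarnessLib

/-!
# NE7TorusRoadSplitClause — CLAUSE (C2) OF THE v4 BUNDLE FROM A LOCAL CHART: the split `D_1(χ•Ã) = φ₁ + E` with `φ₁` `N`-periodic of flat curl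
# `≤ (1 + 12(d+1))ĝ₀(β′, Ma₀)` everywhere and `E` of size `s`, vanishing within `ℓ` blocks of the plaquette's block (file F278b)

Cell `pub-balaban`, rung (B)+1 sub-cell t4, lineage `b2b-balaban-t4-ne7-p1` (CRUX PROVER NE7 #1 = OWNER of row NE7), generation 90; memo
`t4/b2b-balaban-t4-ne7-p1-g90/DEFECT-FAR.md` §4 (instantiation I3 of the torus road).  Over F275 `NE7StraightDefectAssemblyV2`, F276 `NE7SmoothProductCutoff`, F277
`NE7TorusRoadGeometry`, F272 `NE7CoarseSplitAssembly`, F259 `NE7CoarseCurvatureLetterLocal.coarseCurl_le_of_agree`, `NE7TanCriticalGauge.tanCritical_gaugeAct`,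
`NE7CoarseCurvatureLetter.smallField_cavgIter_gaugeAct`.

WHY (memo §4).  F263 `NE7ApeOfTorusRoadV4.hape_of_torusRoadV4` reduces `hape` to a per-plaquette bundle (chart letters, split, two-region defect on straight
tangents, gauge matching, numeric line).  The bundle is discharged from ONE local input — a chart `(u, Ã)` of `U` around the plaquette with `U^u = e^{Ã}` on the
torus ball `|y − z|_{T(MN)} ≤ (nbRad + 2ℓ + 10)·M` and global letters `‖Ã‖ ≤ a₀`, `‖δÃ‖ ≤ a₁` (the shape of [B8] Thm 2 at `U₀ = 1` on nested cubes, (N1)-weak) —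
through the cut-off representative `A = χ•Ã` (`χ` = F276's product cutoff at site scale `M`, plateau radius `ρ₁ = (nbRad + 2ℓ + 6)M`), with constants in closed form.
WHAT ([folklore] composition; 0 def, 0 sorry; dimension `d + 1`, `L ≥ 2`, `N ≥ 4ℓ + 12`).  **`split_clause_of_chart`**: F259's coarse curvature letter at every coarse
plaquette within `2ℓ + 5` blocks of the plaquette's block (its dependency balls lie in the plateau of `χ` by F277 `depRad ≤ nbRad·M`; the datum plaquette is
`β′` by `smallField_cavgIter_gaugeAct`), then F272.
HONEST FRAMING (page 1): composition BY NAME of tree theorems over the chart HYPOTHESIS ((N1)-weak is NOT proved here); nothing of Bałaban's asserted; NOT (APE),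
NOT ONE-STEP, NOT NE7; spine 0∕9; finite T⁴ rung (B)+1 — NOT infinite volume, NOT mass gap, NOT `BetaPertH`, NOT Clay.  Continuum YM on T⁴ ⇐ BetaPertH ∧ nine
spine estimates (0/9 proved); BetaPertH ⇐ (D1) ∧ (D4) ∧ CAP+tail; G-an2-4 gates asym, D1 and NE2/3/4.
-/

set_option autoImplicit false

open scoped BigOperators Matrix.Norms.L2Operator
open NormedSpace Finset Set

namespace Summit.QuantumFields.BalabanUV.T4Continuum.NE7TorusRoadSplitClause

open Literature.MathematicalPhysics.QuantumFieldTheory.Balaban1983to89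
open B7Prop1Explicit B7Prop2Explicit MatrixLog UnitaryModel
open B4ContourShift (supNorm supNorm_nonneg)
open B4TorusKernel.MultiPeriod (circAbs torusSupNorm translate torusSupNorm_translate circAbs_nonneg torusSupNorm_nonneg)
open T4AveragingDeficitWall (IsUnitaryCfg IsSkewDir SmallField vary curlAt dirL1 flat_mem_classes)
open T4AveragingDeficitWallBoundary (IsPeriodicCfg periodBox)
open AveragingDeficitPeriodicCounting (IsPeriodicDir)
open AveragingDeficitMultiLevelPrep (LevelSmall TangentIter cavgIter)
open AveragingDeficitKDatum (isUnitaryCfg_gaugeAct)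
open BlockAverageVaryHolo (nbRad)
open BlockAverageVaryDisc (rho0)
open BlockAverageCurrent (smallField_gaugeAct)
open MinimalActionLevels (perWin)
open NE3HessForm (dAction)
open BlockAveragePushDirSplit (flat)
open NE3TangentFlatStructure (Qcoarse)
open NE3TangentCovariantTower (dirIter tangentIter_iff_dirIter_eq_zero cavgIter_flat)
open NE3LinearisedAverageSup (curvSum)
open NE3QbarIterCovLiftPrep (cruxC)
open NE3RightInverseSolveLetters (thetaLoc)
open NE3HatInvCurlLetters (curl1C curl1C_nonneg)
open NE3QuadRemainderLocality (depRad)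
open NE3SmoothLiftW (isPeriodicCfg_gaugeAct)
open NE3SmoothLiftCurl (curlAt_flat_eq)
open NE3EnergyShapes (IsUnitarySite)
open B5Prop11Plancherel (Tor fine)
open B5Blocks16 (blockOf)
open B6LowerBound2153Torus (toT rep)
open NE7CoarseCurvatureLetter (levelSmall_zero curvSum_zero smallField_cavgIter_gaugeAct)
open NE7CoarseCurvatureLetterLocal (coarseCurl_le_of_agree)
open NE7CoarseSplitAssembly (exists_coarse_split)
open NE7TanCriticalGauge (tanCritical_gaugeAct)
open NE7StraightDefectAssemblyV2 (abs_dAction_cutoffRep_le_twoRegion_straight)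
open NE7SmoothProductCutoff (exists_smooth_cutoff)
open NE7CentredRepresentative (supNorm_add_e_le)
open NE7TorusRoadGeometry (depRad_succ_le tsn_fine_le_of_block_le le_tsn_block_of_le_fine tsn_fine_add_e_le le_tsn_fine_add_e tsn_fine_le_of_slab
  tsn_fine_le_of_l1_ball rep_blockOf_toT_eq tsn_fine_emod)

noncomputable section

variable {d : ℕ} {n : Type*} [Fintype n] [DecidableEq n]

/-- (C2) OF THE BUNDLE FROM THE CHART AND A GIVEN CUTOFF: the split of the linearised top average of `χ•Ã` (F259 at every coarse plaquette within `2ℓ + 5` blocks,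
then F272). [folklore] -/
theorem split_clause_of_chart [Nonempty n] {L : ℕ} [NeZero L] (hL : 2 ≤ L) (k : ℕ) {N ℓ : ℕ} [NeZero N] (hℓ : 1 ≤ ℓ) (hN : 4 * ℓ + 12 ≤ N)
    -- the class radius `ε∕M²` (multi-level smallness) and the current radius `r∕M²`
    {ε r β' : ℝ} (hε : 0 ≤ ε) (hLS : LevelSmall (d + 1) L k (ε / ((L : ℝ) ^ (k + 1)) ^ 2))
    (hθ : cruxC (d + 1) L * ε < 1) (hθl : thetaLoc (d + 1) L * ε < 1) (hε1 : ε ≤ 1) (hr : 0 ≤ r) (hβ' : 0 ≤ β')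
    -- the configuration: unitary, periodic, in the class, tangent-critical, with datum `D` of plaquette radius `β′`
    {U D : Site (d + 1) → Fin (d + 1) → (Matrix n n ℂ)ˣ} (hUu : IsUnitaryCfg U) (hUP : IsPeriodicCfg U ((N * L ^ (k + 1) : ℕ) : ℤ))
    (hUε : SmallField U (ε / ((L : ℝ) ^ (k + 1)) ^ 2)) (hUr : SmallField U (r / ((L : ℝ) ^ (k + 1)) ^ 2))
    (havg : cavgIter L (k + 1) U = D) (hD : SmallField D β')
    (hcrit : ∀ φ : Site (d + 1) → Fin (d + 1) → Matrix n n ℂ, IsSkewDir φ → IsPeriodicDir φ ((N * L ^ (k + 1) : ℕ) : ℤ) → TangentIter L k U φ →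
      dAction U φ (perWin (d + 1) (N * L ^ (k + 1))) = 0)
    -- the plaquette and the chart around it
    (z : Site (d + 1))
    {u : Site (d + 1) → (Matrix n n ℂ)ˣ} (hu : IsUnitarySite u) (huP : ∀ (y : Site (d + 1)) (i : Fin (d + 1)), u (y + ((N * L ^ (k + 1) : ℕ) : ℤ) • e i) = u y)
    {At : Site (d + 1) → Fin (d + 1) → Matrix n n ℂ} (hAt : IsSkewDir At) (hAtP : IsPeriodicDir At ((N * L ^ (k + 1) : ℕ) : ℤ))
    {a₀ a₁ : ℝ} (ha₀ : 0 ≤ a₀) (ha₁ : 0 ≤ a₁) (hAtα : ∀ (y : Site (d + 1)) (κ : Fin (d + 1)), ‖At y κ‖ ≤ a₀)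
    (hAt1 : ∀ (y : Site (d + 1)) (κ τ : Fin (d + 1)), ‖At (y + e τ) κ - At y κ‖ ≤ a₁)
    (hagree : ∀ (y : Site (d + 1)) (κ : Fin (d + 1)),
      torusSupNorm (fun _ : Fin (d + 1) => L ^ (k + 1) * N) (y - z) ≤ (((nbRad (d + 1) L + 2 * ℓ + 10) * L ^ (k + 1) : ℕ) : ℝ) →
        gaugeAct u U y κ = vary (flat (d := d + 1) (n := n)) At 1 y κ)
    -- F51 ∕ F259 smallness of `M·a₀`
    (hσ : 4 * (3 + 12 * ((d + 1 : ℕ) : ℝ)) ^ 2 * (L : ℝ) ^ (k + 1) * a₀ ≤ rho0 (d + 1) L ^ 2)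
    -- the cutoff (F276's, supplied by the caller) and the plateau radius
    (χ : Site (d + 1) → ℝ) (hχP : ∀ (y : Site (d + 1)) (i : Fin (d + 1)), χ (y + ((L ^ (k + 1) * N : ℕ) : ℤ) • e i) = χ y)
    (hχ01 : ∀ y : Site (d + 1), 0 ≤ χ y ∧ χ y ≤ 1)
    (hc1 : ∀ (y : Site (d + 1)) (κ : Fin (d + 1)), |χ (y + e κ) - χ y| ≤ 1 / (L : ℝ) ^ (k + 1))
    {ρ₁ : ℕ} (hρ₁ : ρ₁ = (nbRad (d + 1) L + 2 * ℓ + 6) * L ^ (k + 1))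
    (hplat : ∀ y : Site (d + 1), torusSupNorm (fun _ : Fin (d + 1) => L ^ (k + 1) * N) (y - z) ≤ ρ₁ → χ y = 1)
    :
∃ (φ₁ E : Site (d + 1) → Fin (d + 1) → Matrix n n ℂ),
      (dirIter L (k + 1) (flat (d := d + 1) (n := n)) (fun y κ => χ y • At y κ) = φ₁ + E ∧ IsPeriodicDir φ₁ (N : ℤ) ∧
        (∀ (y : Site (d + 1)) (μ' ν' : Fin (d + 1)), ‖curlAt (flat (d := d + 1) (n := n)) φ₁ y μ' ν'‖
          ≤ (1 + 12 * ((d : ℝ) + 1)) * (β' + 28 * ((3 + 12 * ((d + 1 : ℕ) : ℝ)) * ((L : ℝ) ^ (k + 1) * a₀)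
              + 4 * (3 + 12 * ((d + 1 : ℕ) : ℝ)) ^ 3 / rho0 (d + 1) L ^ 2 * ((L : ℝ) ^ (k + 1) * a₀) ^ 2) ^ 2
              + 4 * (4 * (3 + 12 * ((d + 1 : ℕ) : ℝ)) ^ 3 / rho0 (d + 1) L ^ 2 * ((L : ℝ) ^ (k + 1) * a₀) ^ 2))) ∧
        0 ≤ (3 + 12 * ((d + 1 : ℕ) : ℝ)) * (L : ℝ) ^ (k + 1) * a₀
            + ((d : ℝ) + 1) * (4 * ((ℓ + 1 : ℕ) : ℝ) + 2) * (2 * ((3 + 12 * ((d + 1 : ℕ) : ℝ)) * (L : ℝ) ^ (k + 1) * a₀)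
              + (β' + 28 * ((3 + 12 * ((d + 1 : ℕ) : ℝ)) * ((L : ℝ) ^ (k + 1) * a₀)
                + 4 * (3 + 12 * ((d + 1 : ℕ) : ℝ)) ^ 3 / rho0 (d + 1) L ^ 2 * ((L : ℝ) ^ (k + 1) * a₀) ^ 2) ^ 2
                + 4 * (4 * (3 + 12 * ((d + 1 : ℕ) : ℝ)) ^ 3 / rho0 (d + 1) L ^ 2 * ((L : ℝ) ^ (k + 1) * a₀) ^ 2))) ∧
        (∀ (y : Tor (fun _ : Fin (d + 1) => N)) (lam : Fin (d + 1)), ‖E (rep (fun _ : Fin (d + 1) => N) y) lam‖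
          ≤ (3 + 12 * ((d + 1 : ℕ) : ℝ)) * (L : ℝ) ^ (k + 1) * a₀
            + ((d : ℝ) + 1) * (4 * ((ℓ + 1 : ℕ) : ℝ) + 2) * (2 * ((3 + 12 * ((d + 1 : ℕ) : ℝ)) * (L : ℝ) ^ (k + 1) * a₀)
              + (β' + 28 * ((3 + 12 * ((d + 1 : ℕ) : ℝ)) * ((L : ℝ) ^ (k + 1) * a₀)
                + 4 * (3 + 12 * ((d + 1 : ℕ) : ℝ)) ^ 3 / rho0 (d + 1) L ^ 2 * ((L : ℝ) ^ (k + 1) * a₀) ^ 2) ^ 2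
                + 4 * (4 * (3 + 12 * ((d + 1 : ℕ) : ℝ)) ^ 3 / rho0 (d + 1) L ^ 2 * ((L : ℝ) ^ (k + 1) * a₀) ^ 2)))) ∧
        (∀ (y : Tor (fun _ : Fin (d + 1) => N)), torusSupNorm (fun _ : Fin (d + 1) => N) (rep (fun _ : Fin (d + 1) => N) y
            - rep (fun _ : Fin (d + 1) => N) (B5Blocks16.blockOf (L ^ (k + 1)) (fun _ : Fin (d + 1) => N)
                        (toT (fine (L ^ (k + 1)) (fun _ : Fin (d + 1) => N)) z))) < ℓ →
          ∀ lam : Fin (d + 1), E (rep (fun _ : Fin (d + 1) => N) y) lam = 0)) := by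
  /- §0 numerals -/
  have hL1 : 1 ≤ L := by omega
  have hM1 : 1 ≤ L ^ (k + 1) := Nat.one_le_iff_ne_zero.mpr (pow_ne_zero _ (by omega))
  have hN1 : 1 ≤ N := Nat.one_le_iff_ne_zero.mpr (NeZero.ne N)
  have hMr : ((L ^ (k + 1) : ℕ) : ℝ) = (L : ℝ) ^ (k + 1) := by push_cast; ring
  have hMz : ((L ^ (k + 1) : ℕ) : ℤ) = (L : ℤ) ^ (k + 1) := by push_cast; ring
  have hMpos : (0 : ℝ) < (L : ℝ) ^ (k + 1) := by positivity
  have hMge1 : (1 : ℝ) ≤ (L : ℝ) ^ (k + 1) := by rw [← hMr]; exact_mod_cast hM1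
  have hmc : N * L ^ (k + 1) = L ^ (k + 1) * N := Nat.mul_comm _ _
  have hP1 : 1 ≤ L ^ (k + 1) * N := Nat.one_le_iff_ne_zero.mpr (Nat.mul_ne_zero (pow_ne_zero _ (by omega)) (NeZero.ne N))
  haveI hPnz : NeZero (L ^ (k + 1) * N) := ⟨by omega⟩
  have hnb0 : (0 : ℝ) ≤ (nbRad (d + 1) L : ℝ) := by positivity
  have hℓ1 : (1 : ℝ) ≤ ℓ := by exact_mod_cast hℓ
  -- the plateau radius `ρ₁ = (nb + 2ℓ + 6)M` (sites); the agreement radius is `ρ₁ + 4M`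
  have hρ₁r : (ρ₁ : ℝ) = ((nbRad (d + 1) L : ℝ) + 2 * ℓ + 6) * (L : ℝ) ^ (k + 1) := by rw [hρ₁]; push_cast; ring
  have hRs : (((nbRad (d + 1) L + 2 * ℓ + 10) * L ^ (k + 1) : ℕ) : ℝ) = (ρ₁ : ℝ) + 4 * (L : ℝ) ^ (k + 1) := by
    rw [hρ₁r]; push_cast; ring
  -- the block of `z` on the coarse torus and the reduced corner `z′`
  set c : Site (d + 1) := rep (fun _ : Fin (d + 1) => N) (B5Blocks16.blockOf (L ^ (k + 1)) (fun _ : Fin (d + 1) => N)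
      (toT (fine (L ^ (k + 1)) (fun _ : Fin (d + 1) => N)) z)) with hc
  have hcz : c = fun i => (z i % ((L ^ (k + 1) * N : ℕ) : ℤ)) / ((L ^ (k + 1) : ℕ) : ℤ) := by rw [hc, rep_blockOf_toT_eq]
  obtain ⟨z', hz'⟩ : ∃ z' : Site (d + 1), z' = fun i => z i % ((L ^ (k + 1) * N : ℕ) : ℤ) := ⟨_, rfl⟩
  have hz'c : ∀ i, 0 ≤ z' i - ((L ^ (k + 1) : ℕ) : ℤ) * c i ∧ z' i - ((L ^ (k + 1) : ℕ) : ℤ) * c i ≤ ((L ^ (k + 1) : ℕ) : ℤ) - 1 := by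
    intro i
    have hM0 : (0 : ℤ) < ((L ^ (k + 1) : ℕ) : ℤ) := by exact_mod_cast (by omega : 0 < L ^ (k + 1))
    have e1 : z' i - ((L ^ (k + 1) : ℕ) : ℤ) * c i = z' i % ((L ^ (k + 1) : ℕ) : ℤ) := by
      rw [hcz, hz']
      have := Int.mul_ediv_add_emod (z i % ((L ^ (k + 1) * N : ℕ) : ℤ)) ((L ^ (k + 1) : ℕ) : ℤ)
      linarith
    rw [e1]
    exact ⟨Int.emod_nonneg _ hM0.ne', by have := Int.emod_lt_of_pos (z' i) hM0; omega⟩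
  have htsnz' : ∀ x : Site (d + 1), torusSupNorm (fun _ : Fin (d + 1) => L ^ (k + 1) * N) (x - z')
      = torusSupNorm (fun _ : Fin (d + 1) => L ^ (k + 1) * N) (x - z) := fun x => by rw [hz']; exact tsn_fine_emod (L ^ (k + 1)) N x z
  /- §1 the gauge-fixed configuration `U′ = U^u` -/
  set U' : Site (d + 1) → Fin (d + 1) → (Matrix n n ℂ)ˣ := gaugeAct u U with hU'
  have hU'u : IsUnitaryCfg U' := isUnitaryCfg_gaugeAct hu hUu
  have hUP' : IsPeriodicCfg U ((L ^ (k + 1) * N : ℕ) : ℤ) := by rw [← hmc]; exact hUP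
  have huP' : ∀ (y : Site (d + 1)) (i : Fin (d + 1)), u (y + ((L ^ (k + 1) * N : ℕ) : ℤ) • e i) = u y := by rw [← hmc]; exact huP
  have hU'P : IsPeriodicCfg U' ((L ^ (k + 1) * N : ℕ) : ℤ) := isPeriodicCfg_gaugeAct huP' hUP'
  have hU'ε : SmallField U' (ε / ((L : ℝ) ^ (k + 1)) ^ 2) := smallField_gaugeAct hu hUε
  have hU'r : SmallField U' (r / ((L : ℝ) ^ (k + 1)) ^ 2) := smallField_gaugeAct hu hUr
  have hx0 : 0 ≤ ε / ((L : ℝ) ^ (k + 1)) ^ 2 := by positivity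
  have ha0 : 0 ≤ r / ((L : ℝ) ^ (k + 1)) ^ 2 := by positivity
  have hxM : ((L : ℝ) ^ (k + 1)) ^ 2 * (ε / ((L : ℝ) ^ (k + 1)) ^ 2) = ε := by field_simp
  have hθ' : cruxC (d + 1) L * (((L : ℝ) ^ (k + 1)) ^ 2 * (ε / ((L : ℝ) ^ (k + 1)) ^ 2)) < 1 := by rw [hxM]; exact hθ
  have hθl' : thetaLoc (d + 1) L * (((L : ℝ) ^ (k + 1)) ^ 2 * (ε / ((L : ℝ) ^ (k + 1)) ^ 2)) < 1 := by rw [hxM]; exact hθl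
  have hε1' : ((L : ℝ) ^ (k + 1)) ^ 2 * (ε / ((L : ℝ) ^ (k + 1)) ^ 2) ≤ 1 := by rw [hxM]; exact hε1
  -- tangent-criticality of `U` in `dirIter` form, transported to `U′`
  have hcritU : ∀ φ : Site (d + 1) → Fin (d + 1) → Matrix n n ℂ, IsSkewDir φ → IsPeriodicDir φ ((L ^ (k + 1) * N : ℕ) : ℤ) →
      dirIter L (k + 1) U φ = 0 → dAction U φ (perWin (d + 1) (L ^ (k + 1) * N)) = 0 := by
    intro φ hφ hφP hφT
    rw [← hmc] at hφP ⊢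
    exact hcrit φ hφ hφP ((tangentIter_iff_dirIter_eq_zero L k U φ).mpr hφT)
  have hcrit' := tanCritical_gaugeAct hL1 k hUu hx0 hLS hUε hu huP' hcritU
  /- §3 the cut-off representative `A = χ•Ã` and its letters -/
  set A : Site (d + 1) → Fin (d + 1) → Matrix n n ℂ := fun y κ => χ y • At y κ with hA
  have hAs : IsSkewDir A := fun y κ => skewAdjoint.smul_mem (χ y) (hAt y κ)
  have hAtP' : IsPeriodicDir At ((L ^ (k + 1) * N : ℕ) : ℤ) := by rw [← hmc]; exact hAtP
  have hAP' : IsPeriodicDir A ((L ^ (k + 1) * N : ℕ) : ℤ) := fun y i κ => by simp only [hA, hχP y i, hAtP' y i κ]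
  have hAP : IsPeriodicDir A ((N * L ^ (k + 1) : ℕ) : ℤ) := by rw [hmc]; exact hAP'
  have hχabs : ∀ y, |χ y| ≤ 1 := fun y => abs_le.mpr ⟨by linarith [(hχ01 y).1], (hχ01 y).2⟩
  have hAα : ∀ (y : Site (d + 1)) (κ : Fin (d + 1)), ‖A y κ‖ ≤ a₀ := by
    intro y κ
    show ‖χ y • At y κ‖ ≤ a₀
    rw [norm_smul, Real.norm_eq_abs]
    calc |χ y| * ‖At y κ‖ ≤ 1 * a₀ := mul_le_mul (hχabs y) (hAtα y κ) (norm_nonneg _) zero_le_one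
      _ = a₀ := one_mul _
  have hc₁0 : (0 : ℝ) ≤ 1 / (L : ℝ) ^ (k + 1) := by positivity
  have hc₂0 : (0 : ℝ) ≤ 2 / ((L : ℝ) ^ (k + 1)) ^ 2 := by positivity
  have hα₁' : 0 ≤ a₁ + 1 / (L : ℝ) ^ (k + 1) * a₀ := by positivity
  have hA1 : ∀ (y : Site (d + 1)) (κ τ : Fin (d + 1)), ‖A (y + e τ) κ - A y κ‖ ≤ a₁ + 1 / (L : ℝ) ^ (k + 1) * a₀ := by
    intro y κ τ
    show ‖χ (y + e τ) • At (y + e τ) κ - χ y • At y κ‖ ≤ _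
    have e1 : χ (y + e τ) • At (y + e τ) κ - χ y • At y κ = χ (y + e τ) • (At (y + e τ) κ - At y κ) + (χ (y + e τ) - χ y) • At y κ := by
      simp only [smul_sub, sub_smul]; abel
    rw [e1]
    refine (norm_add_le _ _).trans (add_le_add ?_ ?_)
    · rw [norm_smul, Real.norm_eq_abs]
      calc |χ (y + e τ)| * ‖At (y + e τ) κ - At y κ‖ ≤ 1 * a₁ := mul_le_mul (hχabs _) (hAt1 y κ τ) (norm_nonneg _) zero_le_one
        _ = a₁ := one_mul _
    · rw [norm_smul, Real.norm_eq_abs]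
      exact mul_le_mul (hc1 y τ) (hAtα y κ) (norm_nonneg _) hc₁0
  -- where `χ = 1`, `e^{A} = e^{Ã}`
  have hvaryA : ∀ (y : Site (d + 1)) (κ : Fin (d + 1)), χ y = 1 →
      vary (flat (d := d + 1) (n := n)) A 1 y κ = vary (flat (d := d + 1) (n := n)) At 1 y κ := by
    intro y κ hy
    show (flat (d := d + 1) (n := n)) y κ * expUnit (((1 : ℝ) : ℂ) • (χ y • At y κ))
      = (flat (d := d + 1) (n := n)) y κ * expUnit (((1 : ℝ) : ℂ) • At y κ)
    rw [hy, one_smul]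
  -- agreement: `U′ = e^{Ã}` on the chart ball, `e^{A} = U′` on the plateau
  have hagreeAt : ∀ (y : Site (d + 1)) (κ : Fin (d + 1)),
      torusSupNorm (fun _ : Fin (d + 1) => L ^ (k + 1) * N) (y - z) ≤ (ρ₁ : ℝ) + 4 * (L : ℝ) ^ (k + 1) →
      U' y κ = vary (flat (d := d + 1) (n := n)) At 1 y κ := by
    intro y κ hy
    exact hagree y κ (by rw [hRs]; exact hy)
  have hagreeA : ∀ (y : Site (d + 1)) (κ : Fin (d + 1)), torusSupNorm (fun _ : Fin (d + 1) => L ^ (k + 1) * N) (y - z) ≤ ρ₁ →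
      vary (flat (d := d + 1) (n := n)) A 1 y κ = U' y κ := by
    intro y κ hy
    rw [hvaryA y κ (hplat y hy), hagreeAt y κ (by linarith [hMpos.le])]
  /- §6 (C2) the split: F259's coarse curvature letter at every coarse plaquette near `c`, then F272 -/
  have hflatU : IsUnitaryCfg (flat (d := d + 1) (n := n)) := (flat_mem_classes (d := d + 1) (n := n) le_rfl).1
  have hflat0 : SmallField (flat (d := d + 1) (n := n)) 0 := (flat_mem_classes (d := d + 1) (n := n) le_rfl).2
  have hflatP : IsPeriodicCfg (flat (d := d + 1) (n := n)) ((L ^ (k + 1) * N : ℕ) : ℤ) := fun _ _ _ => rfl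
  have hF0 : SmallField (cavgIter L (k + 1) (flat (d := d + 1) (n := n))) 0 := by rw [cavgIter_flat]; exact hflat0
  have hVc : SmallField (cavgIter L (k + 1) U') β' := smallField_cavgIter_gaugeAct hL1 k hUu hx0 hLS hUε havg hD hu
  have hdep : (depRad (d + 1) L (k + 1) : ℝ) ≤ (nbRad (d + 1) L : ℝ) * (L : ℝ) ^ (k + 1) := by
    rw [← hMr]; exact_mod_cast depRad_succ_le hL k
  -- the dependency balls of the coarse plaquettes within `2ℓ + 5` blocks of `c` lie in the plateau
  have hball : ∀ (y' : Site (d + 1)), supNorm (y' - c) ≤ ((2 * ℓ + 5 : ℕ) : ℝ) → ∀ (x : Site (d + 1)) (κ : Fin (d + 1)),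
      l1 (x - ((L : ℤ) ^ (k + 1)) • y') ≤ depRad (d + 1) L (k + 1) → vary (flat (d := d + 1) (n := n)) A 1 x κ = U' x κ := by
    intro y' hy' x κ hx
    rw [← hMz] at hx
    refine hagreeA x κ ?_
    have h := tsn_fine_le_of_l1_ball (L ^ (k + 1) * N) (M := L ^ (k + 1)) x y' c z' hx hy' hz'c
    rw [htsnz'] at h
    rw [hMr] at h
    push_cast at h
    rw [hρ₁r]
    have h3 : ((nbRad (d + 1) L : ℝ) + 2 * ℓ + 6) * (L : ℝ) ^ (k + 1)
        = (nbRad (d + 1) L : ℝ) * (L : ℝ) ^ (k + 1) + (L : ℝ) ^ (k + 1) * (2 * (ℓ : ℝ) + 5) + (L : ℝ) ^ (k + 1) := by ring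
    linarith only [h, hdep, h3]
  have hĝ₀ : 0 ≤ (β' + 28 * ((3 + 12 * ((d + 1 : ℕ) : ℝ)) * ((L : ℝ) ^ (k + 1) * a₀)
              + 4 * (3 + 12 * ((d + 1 : ℕ) : ℝ)) ^ 3 / rho0 (d + 1) L ^ 2 * ((L : ℝ) ^ (k + 1) * a₀) ^ 2) ^ 2
              + 4 * (4 * (3 + 12 * ((d + 1 : ℕ) : ℝ)) ^ 3 / rho0 (d + 1) L ^ 2 * ((L : ℝ) ^ (k + 1) * a₀) ^ 2)) := by
    have hK : (0 : ℝ) ≤ 3 + 12 * ((d + 1 : ℕ) : ℝ) := by positivity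
    have hq4 : (0 : ℝ) ≤ 4 * (3 + 12 * ((d + 1 : ℕ) : ℝ)) ^ 3 / rho0 (d + 1) L ^ 2 * ((L : ℝ) ^ (k + 1) * a₀) ^ 2 :=
      mul_nonneg (div_nonneg (mul_nonneg (by norm_num) (pow_nonneg hK 3)) (sq_nonneg _)) (sq_nonneg _)
    exact add_nonneg (add_nonneg hβ' (mul_nonneg (by norm_num) (sq_nonneg _))) (mul_nonneg (by norm_num) hq4)
  have hcurl : ∀ y : Site (d + 1), supNorm (y - c) ≤ 2 * ((ℓ + 1 : ℕ) : ℝ) + 2 → ∀ μ' ν' : Fin (d + 1),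
      ‖curlAt (flat (d := d + 1) (n := n)) (dirIter L (k + 1) (flat (d := d + 1) (n := n)) A) y μ' ν'‖ ≤ (β' + 28 * ((3 + 12 * ((d + 1 : ℕ) : ℝ)) * ((L : ℝ) ^ (k + 1) * a₀)
              + 4 * (3 + 12 * ((d + 1 : ℕ) : ℝ)) ^ 3 / rho0 (d + 1) L ^ 2 * ((L : ℝ) ^ (k + 1) * a₀) ^ 2) ^ 2
              + 4 * (4 * (3 + 12 * ((d + 1 : ℕ) : ℝ)) ^ 3 / rho0 (d + 1) L ^ 2 * ((L : ℝ) ^ (k + 1) * a₀) ^ 2)) := by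
    intro y hy μ' ν'
    by_cases hμν' : μ' = ν'
    · subst hμν'
      rw [curlAt_flat_eq, sub_self, norm_zero]
      exact hĝ₀
    · have hyc : supNorm (y - c) ≤ ((2 * ℓ + 5 : ℕ) : ℝ) := hy.trans (by push_cast; linarith)
      have hyμ : supNorm (y + e μ' - c) ≤ ((2 * ℓ + 5 : ℕ) : ℝ) := by
        have := supNorm_add_e_le (y - c) μ'; rw [show y - c + e μ' = y + e μ' - c by abel] at this; push_cast at hy ⊢; linarith
      have hyν : supNorm (y + e ν' - c) ≤ ((2 * ℓ + 5 : ℕ) : ℝ) := by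
        have := supNorm_add_e_le (y - c) ν'; rw [show y - c + e ν' = y + e ν' - c by abel] at this; push_cast at hy ⊢; linarith
      have hagree259 : ∀ (x : Site (d + 1)) (κ : Fin (d + 1)),
          (l1 (x - ((L : ℤ) ^ (k + 1)) • y) ≤ depRad (d + 1) L (k + 1) ∨ l1 (x - ((L : ℤ) ^ (k + 1)) • (y + e μ')) ≤ depRad (d + 1) L (k + 1)
            ∨ l1 (x - ((L : ℤ) ^ (k + 1)) • (y + e ν')) ≤ depRad (d + 1) L (k + 1)) →
          vary (flat (d := d + 1) (n := n)) A 1 x κ = U' x κ := by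
        intro x κ hx
        rcases hx with h | h | h
        · exact hball y hyc x κ h
        · exact hball (y + e μ') hyμ x κ h
        · exact hball (y + e ν') hyν x κ h
      have h259 := coarseCurl_le_of_agree (n := n) hL k hflatU hflatP hflat0 hF0 hAs hAP' ha₀ hAα hσ y hμν' hagree259 (hVc y μ' ν' hμν')
      rwa [cavgIter_flat] at h259
  obtain ⟨φ₁, E, hsplit, hφP, hφcurl, hs0, hEs, hE0⟩ :=
    exists_coarse_split (n := n) hL k (ℓt := ℓ + 1) (by omega) (by omega) hAs hAP' ha₀ hAα c hĝ₀ hcurl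
  have hE0' : ∀ (y : Tor (fun _ : Fin (d + 1) => N)), torusSupNorm (fun _ : Fin (d + 1) => N) (rep (fun _ : Fin (d + 1) => N) y - c) < ℓ →
      ∀ lam : Fin (d + 1), E (rep (fun _ : Fin (d + 1) => N) y) lam = 0 :=
    fun y hy lam => hE0 _ (by push_cast; linarith) lam
  exact ⟨φ₁, E, hsplit, hφP, hφcurl, hs0, fun y lam => hEs _ lam, hE0'⟩


end

end Summit.QuantumFields.BalabanUV.T4Continuum.NE7TorusRoadSplitClause
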